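import Summits.BirchSwinnertonDyer.BirchSwinnertonDyer.Theorems.EisensteinPrimesBSDpOnCellCTelescopeK2FrobeniusAnnihilator
import Summits.BirchSwinnertonDyer.BirchSwinnertonDyer.Theorems.EisensteinPrimesBSDpOnCellCTelescopeK2InvariantsQuotToH1
import Summits.BirchSwinnertonDyer.BirchSwinnertonDyer.Theorems.EisensteinPrimesBSDpOnCellCTelescopeK2HOneInertiaQuasiIso
import Summits.BirchSwinnertonDyer.BirchSwinnertonDyer.Theorems.EisensteinPrimesBSDpOnCellCTelescopeK2HOneInertiaCofinite
import Summits.BirchSwinnertonDyer.BirchSwinnertonDyer.Theorems.EisensteinPrimesBSDpOnCellCTelescopeK2WeightTwoControlMapOfFrobenius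
import Literature.NumberTheory.EllipticCurves.InertiaCohomologyPrimaryTorsionFiniteProofs
import Literature.NumberTheory.EllipticCurves.ZpExtensionUnramifiedProofs
import Literature.NumberTheory.EllipticCurves.PrimaryTorsionGaloisRep
import HarnessLib

/-!
# Crux 4 `BSDpOnCellC` (stmt-BirchSwinnertonDyer-19034), line «telescope» v10, leaf N2|pub sub-leaf W2 — THE (ann) INPUT OF W2 DISCHARGED
# from N1's fibre data ((div₀) + (fd₀)) at every `w ∤ p` and every `d ∈ Γ_{K_w}`
# (successor LEAD `cruxlead-19034` g3; `--supports`, helper; THEOREMS ONLY; closes no registered stub)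

HONEST FRAMING. No registered stub, no crux, no summit statement is proved; BSD is proved for no curve. This file assembles the
five bricks p755236 (`TelescopeK2FrobeniusAnnihilator`: Cayley–Hamilton through Pontryagin duality), p755760 (`TelescopeK2InvariantsQuotToH1`:
`A^{I}/X·A^{I} ↪ H¹(I, A[X])`), `TelescopeK2HOneFiniteKernel` / `TelescopeK2HOneInertiaQuasiIso` (dévissage along a quasi-isomorphism) and
`TelescopeK2HOneInertiaCofinite` (Greenberg's cofinite-generation criterion) into the hypothesis (ann) of width x2-p2 g19's
`TelescopeK2WeightTwoControlMapOfFrobenius.exists_weightTwoControlMap_of_frobenius_of_heegner` (p752662), VERBATIM in its quantifier shape,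
for a single `(w, d)`; the consumer quantifies over `w ∈ S₀`. Inputs: a discrete `ℤ_p⟦X⟧`-representation `A₂` of `Γ_K` with `X` acting
surjectively ((div₀)) and an additive `Γ_K`-equivariant `θ₀ : A₂[X] → E[p^∞]` with finite kernel AND finite cokernel ((fd₀)), `E/K` an
elliptic curve, `w ∤ p`. TOPOLOGY: (ann) does not mention the topology of `ℤ_p⟦X⟧`; the proof runs the cohomological bricks with the
DISCRETE topology on `ℤ_p⟦X⟧` (for which `ContinuousSMul ℤ_p⟦X⟧ A₂` is automatic) on the same underlying representation — the statement
is proved for the binder's arbitrary topology.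

* **`frobeniusAnnihilator_of_representation`** — the core, for a bare `Representation` with jointly continuous action.
* **`frobeniusAnnihilator_of_fibreData`** — the (ann) clause for `ρ₂ : ContinuousRep Γ_K ℤ_p⟦X⟧ A₂` (any topology on `ℤ_p⟦X⟧`).

References: Jetchev–Skinner–Wan, Camb. J. Math. 5 (2017) §3.4 [JetchevSkinnerWan2017]; R. Greenberg, Doc. Math. Extra Vol. (2006) §3 A
[Greenberg2006]; J.-P. Serre, Cohomologie galoisienne, I §2.2 [SerreGaloisCohomology1997]; J. Milne, ADT I §2 Lemma 2.9 [MilneADT2006].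
-/

set_option autoImplicit false
set_option linter.dupNamespace false

noncomputable section

open CategoryTheory Function
open scoped Pointwise Valued
open Field ValuativeRel IsDedekindDomain NumberField WeierstrassCurve

open Literature.NumberTheory.GaloisRepresentations Literature.NumberTheory.GaloisRepresentations.IsNonarchimedeanLocalField
  Literature.NumberTheory.EllipticCurves Literature.NumberTheory.EllipticCurves.BigGaloisRep

namespace Summit.BirchSwinnertonDyer.BirchSwinnertonDyer.Theorems.TelescopeK2FrobeniusAnnihilatorOfFibre

open Summit.BirchSwinnertonDyer.BirchSwinnertonDyer.Theorems

set_option maxHeartbeats 800000 in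
/-- **(ann) for a bare representation** (core of `frobeniusAnnihilator_of_fibreData`; the topology on `ℤ_p⟦X⟧` is chosen discrete inside).
[cite: JetchevSkinnerWan2017, §3.4] [cite: Greenberg2006, §3 A] -/
theorem frobeniusAnnihilator_of_representation {K : Type} [Field K] [NumberField K] {p : ℕ} [Fact p.Prime]
    (E : WeierstrassCurve K) [E.IsElliptic]
    {A₂ : Type} [AddCommGroup A₂] [Module (PowerSeries ℤ_[p]) A₂] [TopologicalSpace A₂] [DiscreteTopology A₂]
    (σR : Representation (PowerSeries ℤ_[p]) (absoluteGaloisGroup K) A₂)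
    (hσ : Continuous fun q : absoluteGaloisGroup K × A₂ => σR q.1 q.2)
    (hcof : ∀ a : A₂, ∃ b : A₂, (PowerSeries.X : PowerSeries ℤ_[p]) • b = a)
    (θ₀ : Submodule.torsionBy (PowerSeries ℤ_[p]) A₂ (PowerSeries.X : PowerSeries ℤ_[p]) →+ PrimaryTorsion (geomPoints E) p)
    (hθσ : ∀ (g : absoluteGaloisGroup K)
      (a : Submodule.torsionBy (PowerSeries ℤ_[p]) A₂ (PowerSeries.X : PowerSeries ℤ_[p]))
      (hga : σR g (a : A₂) ∈ Submodule.torsionBy (PowerSeries ℤ_[p]) A₂ (PowerSeries.X : PowerSeries ℤ_[p])),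
      θ₀ ⟨σR g (a : A₂), hga⟩ = E.primaryTorsionGaloisRep p g (θ₀ a))
    (hker : Finite θ₀.ker) (hcoker : Finite (PrimaryTorsion (geomPoints E) p ⧸ θ₀.range))
    (w : HeightOneSpectrum (𝓞 K)) (hpw : ((p : ℕ) : 𝓞 K) ∉ w.asIdeal) (d : LocalGroup K (Sum.inl w)) :
    ∃ P : Polynomial (PowerSeries ℤ_[p]), P.Monic ∧
      ∀ a : A₂, (∀ h : LocalGroup K (Sum.inr w), σR (localMap K (Sum.inr w) h) a = a) →
        ∃ a₀ : A₂, (∀ h : LocalGroup K (Sum.inr w), σR (localMap K (Sum.inr w) h) a₀ = a₀) ∧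
          (PowerSeries.X : PowerSeries ℤ_[p]) • a₀ = (Polynomial.aeval (σR (localMap K (Sum.inl w) d)) P) a := by
  classical
  -- the discrete topology on the coefficients
  letI : TopologicalSpace (PowerSeries ℤ_[p]) := ⊥
  haveI : DiscreteTopology (PowerSeries ℤ_[p]) := ⟨rfl⟩
  haveI : ContinuousSMul (PowerSeries ℤ_[p]) A₂ := ⟨continuous_of_discreteTopology⟩
  let ρ : ContinuousRep (absoluteGaloisGroup K) (PowerSeries ℤ_[p]) A₂ := ⟨σR, hσ⟩
  -- the fibre `D = A₂[X]` and its representations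
  haveI : ContinuousSMul (PowerSeries ℤ_[p]) (Submodule.torsionBy (PowerSeries ℤ_[p]) A₂ (PowerSeries.X : PowerSeries ℤ_[p])) :=
    ⟨continuous_of_discreteTopology⟩
  let ρD : ContinuousRep (absoluteGaloisGroup K) (PowerSeries ℤ_[p])
      (Submodule.torsionBy (PowerSeries ℤ_[p]) A₂ (PowerSeries.X : PowerSeries ℤ_[p])) := torsionRep ρ PowerSeries.X
  let ρDw := ρD.restrict (absGaloisRestrict K (w.adicCompletion K))
  let ρZ : ContinuousRep (absoluteGaloisGroup (w.adicCompletion K)) ℤ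
      (Submodule.torsionBy (PowerSeries ℤ_[p]) A₂ (PowerSeries.X : PowerSeries ℤ_[p])) :=
    { toRepresentation :=
        { toFun := fun g => (ρDw g).toAddMonoidHom.toIntLinearMap
          map_one' := LinearMap.ext fun x => by
            change ρDw 1 x = x
            rw [map_one]; rfl
          map_mul' := fun g h => LinearMap.ext fun x => by
            change ρDw (g * h) x = ρDw g (ρDw h x)
            rw [map_mul]; rfl }
      continuous_smul := ρDw.continuous_smul }
  have hρZ : ∀ (g : absoluteGaloisGroup (w.adicCompletion K))
      (x : Submodule.torsionBy (PowerSeries ℤ_[p]) A₂ (PowerSeries.X : PowerSeries ℤ_[p])), ρZ g x = ρDw g x := fun _ _ => rfl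
  let ρEw := (E.primaryTorsionGaloisRep p).restrict (absGaloisRestrict K (w.adicCompletion K))
  let ρEZ : ContinuousRep (absoluteGaloisGroup (w.adicCompletion K)) ℤ (PrimaryTorsion (geomPoints E) p) :=
    { toRepresentation :=
        { toFun := fun g => (ρEw g).toAddMonoidHom.toIntLinearMap
          map_one' := LinearMap.ext fun x => by
            change ρEw 1 x = x
            rw [map_one]; rfl
          map_mul' := fun g h => LinearMap.ext fun x => by
            change ρEw (g * h) x = ρEw g (ρEw h x)
            rw [map_mul]; rfl }
      continuous_smul := ρEw.continuous_smul }
  -- `θ₀` as a morphism of the `ℤ`-representations of `Γ_{K_w}`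
  let f : ρZ.toTopRep ⟶ ρEZ.toTopRep :=
    TopRep.ofHom
      { toLinearMap := θ₀.toIntLinearMap
        cont := continuous_of_discreteTopology
        isIntertwining' := fun γ => by
          refine ContinuousLinearMap.ext fun a => ?_
          change θ₀ (ρDw γ a) = ρEw γ (θ₀ a)
          exact hθσ (absGaloisRestrict K (w.adicCompletion K) γ) a _ }
  have hf : ∀ a, f.hom a = θ₀ a := fun _ => rfl
  -- kernel and cokernel of `f` are those of `θ₀`
  have hker' : Finite (LinearMap.ker f.hom.toLinearMap) := by
    haveI := hker
    exact Finite.of_equiv θ₀.ker (Equiv.subtypeEquivRight fun x => Iff.rfl)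
  have hcoker' : Finite (PrimaryTorsion (geomPoints E) p ⧸ LinearMap.range f.hom.toLinearMap) := by
    haveI := hcoker
    have hle : θ₀.range ≤ (LinearMap.range f.hom.toLinearMap).toAddSubgroup := by
      rintro _ ⟨a, rfl⟩
      exact ⟨a, rfl⟩
    refine Finite.of_surjective (QuotientAddGroup.map θ₀.range (LinearMap.range f.hom.toLinearMap).toAddSubgroup
      (AddMonoidHom.id _) hle) fun q => ?_
    induction q using QuotientAddGroup.induction_on with
    | H e => exact ⟨QuotientAddGroup.mk e, rfl⟩
  -- `p` is prime to the residue characteristic of `K_w`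
  have hp := (Nat.coprime_primes (Fact.out : p.Prime) (ringChar_residueField_prime (F := w.adicCompletion K))).mpr
    (Ne.symm (w.ringChar_residueField_adicCompletion_ne hpw))
  -- `D` is `p`-primary (finite kernel of `θ₀`, `E[p^∞]` `p`-primary)
  have hD : ∀ dd : Submodule.torsionBy (PowerSeries ℤ_[p]) A₂ (PowerSeries.X : PowerSeries ℤ_[p]), ∃ k : ℕ, p ^ k • dd = 0 := by
    intro dd
    haveI := hker
    obtain ⟨k, hk⟩ := (θ₀ dd).exists_pow_smul_eq_zero
    have hk' : p ^ k • θ₀ dd = 0 := PrimaryTorsion.ext (by rw [PrimaryTorsion.val_nsmul, hk, PrimaryTorsion.val_zero])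
    have hmem : p ^ k • dd ∈ θ₀.ker := by rw [AddMonoidHom.mem_ker, map_nsmul, hk']
    have hfin : IsOfFinAddOrder dd := by
      rw [isOfFinAddOrder_iff_nsmul_eq_zero]
      refine ⟨Nat.card θ₀.ker * p ^ k, Nat.mul_pos Nat.card_pos (pow_pos (Fact.out : p.Prime).pos k), ?_⟩
      rw [mul_comm, mul_nsmul]
      have h1 := card_nsmul_eq_zero' (G := θ₀.ker) (x := ⟨p ^ k • dd, hmem⟩)
      exact congrArg Subtype.val h1
    exact TelescopeK2WeightTwoControlMapOfFrobenius.exists_pow_smul_eq_zero_of_isOfFinAddOrder hfin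
  have hEdiv : ∀ e : PrimaryTorsion (geomPoints E) p, ∃ b : PrimaryTorsion (geomPoints E) p, p • b = e := fun e => by
    obtain ⟨b, hb⟩ := E.exists_prime_pow_nsmul_eq_primaryTorsion p 1 e
    exact ⟨b, by rw [pow_one] at hb; exact hb⟩
  haveI : Finite (Submodule.torsionBy ℤ (PrimaryTorsion (geomPoints E) p) (p : ℤ)) := by
    have h := E.finite_torsionBy_int_primaryTorsion p 1
    rwa [pow_one] at h
  -- brick 4: `H¹(I_w, D_ℤ)[p]` is finite
  have hfinZ := TelescopeK2HOneInertiaQuasiIso.finite_setOf_smul_eq_zero_h1_absInertia_of_hom (w.adicCompletion K)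
    ρZ ρEZ f hker' hcoker' hp hD hEdiv
  -- brick 5: `H¹(I_w, D)^∨` is finitely generated over `ℤ_p⟦X⟧`
  have e : PowerSeries ℤ_[p] ≃+* MvPowerSeries (Fin 1) ℤ_[p] :=
    (MvPowerSeries.renameEquiv ℤ_[p] (finOneEquiv.symm : Unit ≃ Fin 1)).toRingEquiv
  have hX : ∀ dd : Submodule.torsionBy (PowerSeries ℤ_[p]) A₂ (PowerSeries.X : PowerSeries ℤ_[p]),
      (PowerSeries.X : PowerSeries ℤ_[p]) • dd = 0 := fun dd =>
    Subtype.ext (by rw [Submodule.coe_smul, Submodule.coe_zero]; exact (Submodule.mem_torsionBy_iff _ _).1 dd.2)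
  have hH := TelescopeK2HOneInertiaCofinite.module_finite_characterModule_h1_absInertia e ρDw ρZ hρZ hX hD hfinZ
  -- brick 2: the invariants quotient `A₂^{I_w}/X·A₂^{I_w}` has finitely generated dual
  let ρAI : ContinuousRep (absInertia (w.adicCompletion K)) (PowerSeries ℤ_[p]) A₂ :=
    (ρ.restrict (absGaloisRestrict K (w.adicCompletion K))).restrict
      (Literature.NumberTheory.GaloisRepresentations.subgroupIncl (absInertia (w.adicCompletion K)))
  have hH' : Module.Finite (PowerSeries ℤ_[p])
      (CharacterModule (continuousCohomology 1 (torsionRep ρAI (PowerSeries.X : PowerSeries ℤ_[p])).toTopRep)) := hH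
  have hQ := TelescopeK2InvariantsQuotToH1.finite_characterModule_invariantsQuot_of_h1 ρAI (PowerSeries.X : PowerSeries ℤ_[p]) hcof hH'
  have hV : ρAI.toTopRep.ρ.invariants =
      ⨅ h : LocalGroup K (Sum.inr w), LinearMap.eqLocus (ρ (localMap K (Sum.inr w) h)) LinearMap.id := by
    ext a
    simp only [Submodule.mem_iInf, LinearMap.mem_eqLocus, LinearMap.id_apply]
    exact ⟨fun ha h => ha h, fun ha h => ha h⟩
  rw [hV] at hQ
  -- brick 1: Cayley–Hamilton through Pontryagin duality
  exact TelescopeK2FrobeniusAnnihilator.frobeniusAnnihilator_of_finite ρ (PowerSeries.X : PowerSeries ℤ_[p]) w d hQ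

/-- **The (ann) input of W2, discharged from N1's fibre data.** `ρ₂ : Γ_K → Aut_{ℤ_p⟦X⟧}(A₂)` a discrete continuous representation (ANY
topology on `ℤ_p⟦X⟧`), `X` acting surjectively on `A₂` ((div₀)), `θ₀ : A₂[X] → E[p^∞]` additive and `Γ_K`-equivariant with finite kernel
and finite cokernel ((fd₀)), `w ∤ p` a finite place and `d ∈ Γ_{K_w}`: there is a MONIC `P ∈ ℤ_p⟦X⟧[Y]` such that every `I_w`-invariant
`a ∈ A₂` has an `I_w`-invariant `a₀` with `X • a₀ = P(ρ₂(res d)) a` — the hypothesis `hann` of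
`TelescopeK2WeightTwoControlMapOfFrobenius.exists_weightTwoControlMap_of_frobenius_of_heegner` at `(w, d)`.
[cite: JetchevSkinnerWan2017, §3.4, Lemma 3.4.1] [cite: Greenberg2006, §3 A (Prop. 3.1–3.2)] [cite: SerreGaloisCohomology1997, I §2.2]
[cite: MilneADT2006, I §2 Lemma 2.9] -/
theorem frobeniusAnnihilator_of_fibreData {K : Type} [Field K] [NumberField K] {p : ℕ} [Fact p.Prime]
    (E : WeierstrassCurve K) [E.IsElliptic] [TopologicalSpace (PowerSeries ℤ_[p])]
    {A₂ : Type} [AddCommGroup A₂] [Module (PowerSeries ℤ_[p]) A₂] [TopologicalSpace A₂] [DiscreteTopology A₂]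
    (ρ₂ : ContinuousRep (absoluteGaloisGroup K) (PowerSeries ℤ_[p]) A₂)
    (hcof : ∀ a : A₂, ∃ b : A₂, (PowerSeries.X : PowerSeries ℤ_[p]) • b = a)
    (θ₀ : Submodule.torsionBy (PowerSeries ℤ_[p]) A₂ (PowerSeries.X : PowerSeries ℤ_[p]) →+ PrimaryTorsion (geomPoints E) p)
    (hθσ : ∀ (σ : absoluteGaloisGroup K)
      (a : Submodule.torsionBy (PowerSeries ℤ_[p]) A₂ (PowerSeries.X : PowerSeries ℤ_[p])),
      θ₀ (torsionRep ρ₂ (PowerSeries.X : PowerSeries ℤ_[p]) σ a) = E.primaryTorsionGaloisRep p σ (θ₀ a))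
    (hker : Finite θ₀.ker) (hcoker : Finite (PrimaryTorsion (geomPoints E) p ⧸ θ₀.range))
    (w : HeightOneSpectrum (𝓞 K)) (hpw : ((p : ℕ) : 𝓞 K) ∉ w.asIdeal) (d : LocalGroup K (Sum.inl w)) :
    ∃ P : Polynomial (PowerSeries ℤ_[p]), P.Monic ∧
      ∀ a : A₂, (∀ h : LocalGroup K (Sum.inr w), ρ₂ (localMap K (Sum.inr w) h) a = a) →
        ∃ a₀ : A₂, (∀ h : LocalGroup K (Sum.inr w), ρ₂ (localMap K (Sum.inr w) h) a₀ = a₀) ∧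
          (PowerSeries.X : PowerSeries ℤ_[p]) • a₀ = (Polynomial.aeval (ρ₂ (localMap K (Sum.inl w) d)) P) a :=
  frobeniusAnnihilator_of_representation E ρ₂.toRepresentation ρ₂.continuous_smul hcof θ₀
    (fun g a _ => hθσ g a) hker hcoker w hpw d

end Summit.BirchSwinnertonDyer.BirchSwinnertonDyer.Theorems.TelescopeK2FrobeniusAnnihilatorOfFibre

end
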